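import Mathlib
import Literature.Analysis.Calculus.SmoothCutoff
import Summits.AnomalousDissipation.AnomalousDissipation.Theorems.DyadicWallCascadeDyadicRealisationFluxSignTools
import HarnessLib

/-!
# Cell-averaging tools for the rate obstruction `NoFastBlowDown` (Tools A)

Tools file A of the unconditional rate obstruction `NoFastBlowDown` for the witnesses of the crux
`Summit.AnomalousDissipation.AnomalousDissipation.Theses.DyadicWallCascade.ViscousContinuation`
(stmt-AnomalousDissipation-17917, line SketchIdeator4, lead c1).

The endgame of the rate obstruction averages horizontally against the weight
`ρ(x, y) = k(x) k(y)`, where `k` is a two-cell partition-of-unity profile (`k = 0` off `(0, 2)`,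
`k(t) + k(t + 1) = 1` on `[0, 1]`); for `1`-periodic integrands this weighted integral is
exactly the unit-cell average (tree lemma `fluxSign_cell_average_one`).  This file supplies:

* `noFastBlowDown_cell_profile` — a smooth such profile `k = S − S(· − 1)` (`S` is Mathlib's
  `Real.smoothTransition`) together with its derivative `k' = S' − S'(· − 1)`, `k > 0` on `(0, 2)`;
* `noFastBlowDown_cell_integral_deriv` — `∫ k' h = 0` for continuous `1`-periodic `h`;
* `noFastBlowDown_cell_half_one`, `noFastBlowDown_cell_half_two` — `∫ k(t) h(t/2) dt = ∫ k h`
  for `½`-periodic `h`, in one and in two variables;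
* `noFastBlowDown_cell_mixed` — the mixed `k' ⊗ k`, `k ⊗ k'` moments vanish against integrands
  that are `1`-periodic in the differentiated variable;
* `noFastBlowDown_cell_vanish` — a continuous nonnegative `k ⊗ k · h` with zero integral forces
  `h = 0` wherever `k ⊗ k > 0`.

All statements are folklore calculus; the file ends with the registered tools stub
`stub_noFastBlowDownCellTools` (conjunction of the six statements).
-/

open MeasureTheory Set Filter Topology Function
open Literature.Analysis.Calculus

set_option linter.dupNamespace false

namespace Summit.AnomalousDissipation.AnomalousDissipation.Theorems

/-! ## The two-cell profile -/

/-- **The two-cell profile.** There is a smooth compactly supported `k ≥ 0` on `ℝ`, positive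
exactly on `(0, 2)` among `t ∈ (0, 2)`, vanishing on `t ≤ 0` and on `t ≥ 2`, with
`k(t) + k(t + 1) = 1` on `[0, 1]`, together with its (continuous) derivative `k'`, which vanishes
on `t ≤ 0`, on `t ≥ 2`, and satisfies `k'(t) + k'(t + 1) = 0` on `[0, 1]`.  Take
`k = S − S(· − 1)`, `k' = S' − S'(· − 1)` with `S = Real.smoothTransition`. [folklore] -/
theorem noFastBlowDown_cell_profile :
    ∃ k k' : ℝ → ℝ, ContDiff ℝ ((⊤ : ℕ∞) : WithTop ℕ∞) k ∧ Continuous k ∧ Continuous k' ∧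
      HasCompactSupport k ∧ (∀ t, HasDerivAt k (k' t) t) ∧ (∀ t, 0 ≤ k t) ∧
      (∀ t, 0 < t → t < 2 → 0 < k t) ∧ (∀ t, t ≤ 0 → k t = 0) ∧ (∀ t, 2 ≤ t → k t = 0) ∧
      (∀ t, 0 ≤ t → t ≤ 1 → k t + k (t + 1) = 1) ∧ (∀ t, t ≤ 0 → k' t = 0) ∧
      (∀ t, 2 ≤ t → k' t = 0) ∧ (∀ t, 0 ≤ t → t ≤ 1 → k' t + k' (t + 1) = 0) := by
  set S := Real.smoothTransition
  set S1 := deriv Real.smoothTransition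
  have hS0 : ∀ t, t ≤ 0 → S t = 0 := fun t => Real.smoothTransition.zero_of_nonpos
  have hSone : ∀ t, 1 ≤ t → S t = 1 := fun t => Real.smoothTransition.one_of_one_le
  have hS10 : ∀ t, t ≤ 0 → S1 t = 0 := fun t => deriv_smoothTransition_of_nonpos
  have hS11 : ∀ t, 1 ≤ t → S1 t = 0 := fun t => deriv_smoothTransition_of_one_le
  refine ⟨fun t => S t - S (t - 1), fun t => S1 t - S1 (t - 1), ?_, ?_, ?_, ?_, ?_, ?_, ?_, ?_,
    ?_, ?_, ?_, ?_, ?_⟩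
  · exact Real.smoothTransition.contDiff.sub
      (Real.smoothTransition.contDiff.comp (contDiff_id.sub contDiff_const))
  · exact Real.smoothTransition.continuous.sub
      (Real.smoothTransition.continuous.comp (continuous_sub_right 1))
  · have hc : Continuous S1 := (Real.smoothTransition.contDiff (n := 1)).continuous_deriv le_rfl
    exact hc.sub (hc.comp (continuous_sub_right 1))
  · refine HasCompactSupport.of_support_subset_isCompact (isCompact_Icc (a := (0 : ℝ)) (b := 2))
      fun t ht => ?_
    rw [mem_support] at ht
    constructor
    · by_contra h
      refine ht ?_
      show S t - S (t - 1) = 0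
      rw [hS0 t (not_le.1 h).le, hS0 (t - 1) (by linarith [not_le.1 h]), sub_zero]
    · by_contra h
      refine ht ?_
      show S t - S (t - 1) = 0
      rw [hSone t (by linarith [not_le.1 h]), hSone (t - 1) (by linarith [not_le.1 h]), sub_self]
  · intro t
    have h1 : HasDerivAt S (S1 t) t := (differentiable_smoothTransition t).hasDerivAt
    have h2 : HasDerivAt (fun x => S (x - 1)) (S1 (t - 1)) t :=
      HasDerivAt.comp_sub_const t 1 (differentiable_smoothTransition (t - 1)).hasDerivAt
    exact h1.sub h2
  · intro t
    exact sub_nonneg.2 (Real.smoothTransition.monotone (by linarith))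
  · intro t h0 h2
    show 0 < S t - S (t - 1)
    rcases le_or_gt t 1 with h1 | h1
    · rw [hS0 (t - 1) (by linarith), sub_zero]
      exact Real.smoothTransition.pos_of_pos h0
    · rw [hSone t h1.le]
      exact sub_pos.2 (Real.smoothTransition.lt_one_of_lt_one (by linarith))
  · intro t ht
    show S t - S (t - 1) = 0
    rw [hS0 t ht, hS0 (t - 1) (by linarith), sub_zero]
  · intro t ht
    show S t - S (t - 1) = 0
    rw [hSone t (by linarith), hSone (t - 1) (by linarith), sub_self]
  · intro t h0 h1
    show S t - S (t - 1) + (S (t + 1) - S (t + 1 - 1)) = 1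
    rw [add_sub_cancel_right, hSone (t + 1) (by linarith), hS0 (t - 1) (by linarith)]
    ring
  · intro t ht
    show S1 t - S1 (t - 1) = 0
    rw [hS10 t ht, hS10 (t - 1) (by linarith), sub_zero]
  · intro t ht
    show S1 t - S1 (t - 1) = 0
    rw [hS11 t (by linarith), hS11 (t - 1) (by linarith), sub_self]
  · intro t h0 h1
    show S1 t - S1 (t - 1) + (S1 (t + 1) - S1 (t + 1 - 1)) = 0
    rw [add_sub_cancel_right, hS11 (t + 1) (by linarith), hS10 (t - 1) (by linarith)]
    ring

/-! ## Integrability and continuity of cell integrands -/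

/-- A product integrand `a(t) h(t)` with `a` vanishing on `t ≤ 0` and on `t ≥ 2` is supported in
`(0, 2]`. [folklore] -/
theorem noFastBlowDown_cell_support_subset (a h : ℝ → ℝ) (ha0 : ∀ t, t ≤ 0 → a t = 0)
    (ha2 : ∀ t, 2 ≤ t → a t = 0) : support (fun t => a t * h t) ⊆ Ioc (0 : ℝ) 2 := by
  intro t ht
  rw [mem_support] at ht
  refine ⟨?_, ?_⟩
  · by_contra hc
    exact ht (by rw [ha0 t (not_lt.1 hc), zero_mul])
  · by_contra hc
    exact ht (by rw [ha2 t (le_of_lt (not_le.1 hc)), zero_mul])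

/-- Integrability on `ℝ` of `a h` for continuous `a`, `h` with `a` vanishing on `t ≤ 0` and on
`t ≥ 2` (continuous with compact support in `[0, 2]`). [folklore] -/
theorem noFastBlowDown_cell_integrable_one (a h : ℝ → ℝ) (ha : Continuous a) (hh : Continuous h)
    (ha0 : ∀ t, t ≤ 0 → a t = 0) (ha2 : ∀ t, 2 ≤ t → a t = 0) :
    Integrable (fun t => a t * h t) :=
  (ha.mul hh).integrable_of_hasCompactSupport
    (HasCompactSupport.of_support_subset_isCompact (isCompact_Icc (a := (0 : ℝ)) (b := 2))
      ((noFastBlowDown_cell_support_subset a h ha0 ha2).trans Ioc_subset_Icc_self))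

/-- Integrability on `ℝ²` of `a(x) b(y) H(x, y)` for continuous data with `a`, `b` vanishing on
`t ≤ 0` and on `t ≥ 2` (continuous with compact support in `[0, 2]²`). [folklore] -/
theorem noFastBlowDown_cell_integrable_two (a b : ℝ → ℝ) (H : ℝ × ℝ → ℝ) (ha : Continuous a)
    (hb : Continuous b) (hH : Continuous H) (ha0 : ∀ t, t ≤ 0 → a t = 0)
    (ha2 : ∀ t, 2 ≤ t → a t = 0) (hb0 : ∀ t, t ≤ 0 → b t = 0) (hb2 : ∀ t, 2 ≤ t → b t = 0) :
    Integrable (fun q : ℝ × ℝ => a q.1 * b q.2 * H q) (volume.prod volume) := by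
  have hc : Continuous fun q : ℝ × ℝ => a q.1 * b q.2 * H q :=
    ((ha.comp continuous_fst).mul (hb.comp continuous_snd)).mul hH
  refine hc.integrable_of_hasCompactSupport ?_
  refine HasCompactSupport.of_support_subset_isCompact
    ((isCompact_Icc (a := (0 : ℝ)) (b := 2)).prod (isCompact_Icc (a := (0 : ℝ)) (b := 2))) ?_
  intro q hq
  rw [mem_support] at hq
  have h1 : a q.1 ≠ 0 := fun h0 => hq (by rw [h0, zero_mul, zero_mul])
  have h2 : b q.2 ≠ 0 := fun h0 => hq (by rw [h0, mul_zero, zero_mul])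
  refine ⟨⟨?_, ?_⟩, ⟨?_, ?_⟩⟩
  · by_contra hc'; exact h1 (ha0 _ (le_of_lt (not_le.1 hc')))
  · by_contra hc'; exact h1 (ha2 _ (le_of_lt (not_le.1 hc')))
  · by_contra hc'; exact h2 (hb0 _ (le_of_lt (not_le.1 hc')))
  · by_contra hc'; exact h2 (hb2 _ (le_of_lt (not_le.1 hc')))

/-- Continuity of the cell integral `x ↦ ∫ a(y) H(x, y) dy` for continuous data with `a`
vanishing on `t ≤ 0` and on `t ≥ 2` (a parametric integral over the compact interval `[0, 2]`).
[folklore] -/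
theorem noFastBlowDown_cell_continuous_param (a : ℝ → ℝ) (H : ℝ × ℝ → ℝ) (ha : Continuous a)
    (hH : Continuous H) (ha0 : ∀ t, t ≤ 0 → a t = 0) (ha2 : ∀ t, 2 ≤ t → a t = 0) :
    Continuous fun x => ∫ y, a y * H (x, y) := by
  have heq : (fun x => ∫ y, a y * H (x, y)) = fun x => ∫ y in (0 : ℝ)..2, a y * H (x, y) := by
    funext x
    exact (intervalIntegral.integral_eq_integral_of_support_subset
      (noFastBlowDown_cell_support_subset a (fun y => H (x, y)) ha0 ha2)).symm
  rw [heq]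
  exact intervalIntegral.continuous_parametric_intervalIntegral_of_continuous'
    (f := fun x y => a y * H (x, y)) ((ha.comp continuous_snd).mul hH) 0 2

/-! ## One-variable cell identities -/

/-- **The `k'`-moment of a periodic function vanishes.** If `k` is a two-cell partition-of-unity
profile and `k'` is continuous, vanishes on `t ≤ 0` and on `t ≥ 2` and satisfies
`k'(t) + k'(t + 1) = 0` on `[0, 1]` (as the derivative of `k` does), then `∫ k' h = 0` for every
continuous `1`-periodic `h`: `k + k'` is again a partition-of-unity profile, so
`∫ (k + k') h = ∫₀¹ h = ∫ k h` by `fluxSign_cell_average_one`. [folklore] -/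
theorem noFastBlowDown_cell_integral_deriv (k k' h : ℝ → ℝ) (hk : Continuous k)
    (hk' : Continuous k') (hh : Continuous h) (hk0 : ∀ t, t ≤ 0 → k t = 0)
    (hk2 : ∀ t, 2 ≤ t → k t = 0) (hk1 : ∀ t, 0 ≤ t → t ≤ 1 → k t + k (t + 1) = 1)
    (hk'0 : ∀ t, t ≤ 0 → k' t = 0) (hk'2 : ∀ t, 2 ≤ t → k' t = 0)
    (hk'1 : ∀ t, 0 ≤ t → t ≤ 1 → k' t + k' (t + 1) = 0) (hper : ∀ t, h (t + 1) = h t) :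
    ∫ t, k' t * h t = 0 := by
  have h1 := fluxSign_cell_average_one k h hk hh hk0 hk2 hk1 hper
  have h2 := fluxSign_cell_average_one (fun t => k t + k' t) h (hk.add hk') hh
    (fun t ht => by
      show k t + k' t = 0
      rw [hk0 t ht, hk'0 t ht, add_zero])
    (fun t ht => by
      show k t + k' t = 0
      rw [hk2 t ht, hk'2 t ht, add_zero])
    (fun t h0 h1' => by
      show k t + k' t + (k (t + 1) + k' (t + 1)) = 1
      linarith [hk1 t h0 h1', hk'1 t h0 h1']) hper
  simp only [add_mul] at h2
  rw [integral_add (noFastBlowDown_cell_integrable_one k h hk hh hk0 hk2)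
    (noFastBlowDown_cell_integrable_one k' h hk' hh hk'0 hk'2), h1] at h2
  linarith

/-- **Half-period rescaling in one variable.** For a two-cell partition-of-unity profile `k` and
a continuous `½`-periodic `h`, `∫ k(t) h(t/2) dt = ∫ k h`: both sides equal `∫₀¹ h`, since
`h(·/2)` is `1`-periodic and `∫₀¹ h(s/2) ds = 2 ∫₀^{1/2} h = ∫₀¹ h`. [folklore] -/
theorem noFastBlowDown_cell_half_one (k h : ℝ → ℝ) (hk : Continuous k) (hh : Continuous h)
    (hk0 : ∀ t, t ≤ 0 → k t = 0) (hk2 : ∀ t, 2 ≤ t → k t = 0)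
    (hk1 : ∀ t, 0 ≤ t → t ≤ 1 → k t + k (t + 1) = 1) (hper : ∀ t, h (t + 1 / 2) = h t) :
    ∫ t, k t * h (t / 2) = ∫ t, k t * h t := by
  have hper1 : ∀ t, h (t + 1) = h t := fun t => by
    rw [show t + 1 = t + 1 / 2 + 1 / 2 by ring, hper, hper]
  have hper2 : ∀ t, h ((t + 1) / 2) = h (t / 2) := fun t => by
    rw [show (t + 1) / 2 = t / 2 + 1 / 2 by ring, hper]
  have hA : ∫ t, k t * h (t / 2) = ∫ t in (0 : ℝ)..1, h (t / 2) :=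
    fluxSign_cell_average_one k (fun t => h (t / 2)) hk (by fun_prop) hk0 hk2 hk1 hper2
  have hB : ∫ t, k t * h t = ∫ t in (0 : ℝ)..1, h t :=
    fluxSign_cell_average_one k h hk hh hk0 hk2 hk1 hper1
  have hC : ∫ t in (0 : ℝ)..1, h (t / 2) = 2 * ∫ t in (0 : ℝ)..1 / 2, h t := by
    have := intervalIntegral.integral_comp_div (a := 0) (b := 1) h (two_ne_zero (α := ℝ))
    rw [zero_div, smul_eq_mul] at this
    exact this
  have hD : ∫ t in (1 / 2 : ℝ)..1, h t = ∫ t in (0 : ℝ)..1 / 2, h t := by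
    have := intervalIntegral.integral_comp_add_right (a := 0) (b := 1 / 2) h (1 / 2)
    rw [zero_add, add_halves] at this
    rw [← this]
    simp_rw [hper]
  rw [hA, hB, hC, ← intervalIntegral.integral_add_adjacent_intervals (hh.intervalIntegrable 0 (1 / 2))
      (hh.intervalIntegrable (1 / 2) 1), hD, two_mul]

/-! ## Two-variable cell identities -/

/-- **Half-period rescaling in two variables.** For a two-cell partition-of-unity profile `k`
and a continuous `h : ℝ² → ℝ` that is `½`-periodic in both variables,
`∫∫ k(x) k(y) h(x/2, y/2) = ∫∫ k(x) k(y) h(x, y)` (Fubini and the one-variable identity applied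
first in the inner variable, then to the continuous `½`-periodic cell integral
`x ↦ ∫ k(y) h(x, y) dy`). [folklore] -/
theorem noFastBlowDown_cell_half_two (k : ℝ → ℝ) (h : ℝ × ℝ → ℝ) (hk : Continuous k)
    (hh : Continuous h) (hk0 : ∀ t, t ≤ 0 → k t = 0) (hk2 : ∀ t, 2 ≤ t → k t = 0)
    (hk1 : ∀ t, 0 ≤ t → t ≤ 1 → k t + k (t + 1) = 1)
    (hper1 : ∀ q : ℝ × ℝ, h (q.1 + 1 / 2, q.2) = h q)
    (hper2 : ∀ q : ℝ × ℝ, h (q.1, q.2 + 1 / 2) = h q) :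
    ∫ q : ℝ × ℝ, k q.1 * k q.2 * h (q.1 / 2, q.2 / 2) = ∫ q : ℝ × ℝ, k q.1 * k q.2 * h q := by
  have hh2 : Continuous fun q : ℝ × ℝ => h (q.1 / 2, q.2 / 2) := by fun_prop
  rw [Measure.volume_eq_prod,
    integral_prod _ (noFastBlowDown_cell_integrable_two k k _ hk hk hh2 hk0 hk2 hk0 hk2),
    integral_prod _ (noFastBlowDown_cell_integrable_two k k h hk hk hh hk0 hk2 hk0 hk2)]
  have hGc : Continuous fun x => ∫ y, k y * h (x, y) :=
    noFastBlowDown_cell_continuous_param k h hk hh hk0 hk2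
  have hGper : ∀ x, (∫ y, k y * h (x + 1 / 2, y)) = ∫ y, k y * h (x, y) := fun x => by
    congr 1
    funext y
    rw [show h (x + 1 / 2, y) = h (x, y) from hper1 (x, y)]
  have hin1 : ∀ x : ℝ, ∫ y, k (x, y).1 * k (x, y).2 * h ((x, y).1 / 2, (x, y).2 / 2) =
      k x * ∫ y, k y * h (x / 2, y) := by
    intro x
    simp only
    simp_rw [mul_assoc]
    rw [integral_const_mul]
    congr 1
    exact noFastBlowDown_cell_half_one k (fun y => h (x / 2, y)) hk (by fun_prop) hk0 hk2 hk1
      (fun y => hper2 (x / 2, y))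
  have hin2 : ∀ x : ℝ, ∫ y, k (x, y).1 * k (x, y).2 * h (x, y) = k x * ∫ y, k y * h (x, y) := by
    intro x
    simp only
    simp_rw [mul_assoc]
    exact integral_const_mul _ _
  simp only [hin1, hin2]
  exact noFastBlowDown_cell_half_one k (fun x => ∫ y, k y * h (x, y)) hk hGc hk0 hk2 hk1 hGper

/-- **Mixed moments vanish.** For a two-cell partition-of-unity profile `k`, a continuous `k'`
vanishing on `t ≤ 0` and on `t ≥ 2` with `k'(t) + k'(t + 1) = 0` on `[0, 1]`, and a continuous
`h : ℝ² → ℝ`: if `h` is `1`-periodic in `x` then `∫∫ k'(x) k(y) h = 0`, and if `h` is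
`1`-periodic in `y` then `∫∫ k(x) k'(y) h = 0` (Fubini and `noFastBlowDown_cell_integral_deriv`,
applied to the continuous periodic cell integral `x ↦ ∫ k(y) h(x, y) dy`, resp. to the slices).
[folklore] -/
theorem noFastBlowDown_cell_mixed (k k' : ℝ → ℝ) (h : ℝ × ℝ → ℝ) (hk : Continuous k)
    (hk' : Continuous k') (hh : Continuous h) (hk0 : ∀ t, t ≤ 0 → k t = 0)
    (hk2 : ∀ t, 2 ≤ t → k t = 0) (hk1 : ∀ t, 0 ≤ t → t ≤ 1 → k t + k (t + 1) = 1)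
    (hk'0 : ∀ t, t ≤ 0 → k' t = 0) (hk'2 : ∀ t, 2 ≤ t → k' t = 0)
    (hk'1 : ∀ t, 0 ≤ t → t ≤ 1 → k' t + k' (t + 1) = 0) :
    ((∀ q : ℝ × ℝ, h (q.1 + 1, q.2) = h q) → ∫ q : ℝ × ℝ, k' q.1 * k q.2 * h q = 0) ∧
      ((∀ q : ℝ × ℝ, h (q.1, q.2 + 1) = h q) → ∫ q : ℝ × ℝ, k q.1 * k' q.2 * h q = 0) := by
  constructor
  · intro hper
    rw [Measure.volume_eq_prod,
      integral_prod _ (noFastBlowDown_cell_integrable_two k' k h hk' hk hh hk'0 hk'2 hk0 hk2)]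
    have hGc : Continuous fun x => ∫ y, k y * h (x, y) :=
      noFastBlowDown_cell_continuous_param k h hk hh hk0 hk2
    have hGper : ∀ x, (∫ y, k y * h (x + 1, y)) = ∫ y, k y * h (x, y) := fun x => by
      congr 1
      funext y
      rw [show h (x + 1, y) = h (x, y) from hper (x, y)]
    have hin : ∀ x : ℝ, ∫ y, k' (x, y).1 * k (x, y).2 * h (x, y) = k' x * ∫ y, k y * h (x, y) := by
      intro x
      simp only
      simp_rw [mul_assoc]
      exact integral_const_mul _ _
    simp only [hin]
    exact noFastBlowDown_cell_integral_deriv k k' (fun x => ∫ y, k y * h (x, y)) hk hk' hGc hk0 hk2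
      hk1 hk'0 hk'2 hk'1 hGper
  · intro hper
    rw [Measure.volume_eq_prod,
      integral_prod _ (noFastBlowDown_cell_integrable_two k k' h hk hk' hh hk0 hk2 hk'0 hk'2)]
    have hin : ∀ x : ℝ, ∫ y, k (x, y).1 * k' (x, y).2 * h (x, y) = 0 := by
      intro x
      have h0 : ∫ y, k' y * h (x, y) = 0 :=
        noFastBlowDown_cell_integral_deriv k k' (fun y => h (x, y)) hk hk' (by fun_prop) hk0 hk2 hk1
          hk'0 hk'2 hk'1 (fun y => hper (x, y))
      simp only
      simp_rw [mul_assoc]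
      rw [integral_const_mul, h0, mul_zero]
    simp only [hin, integral_zero]

/-- **Vanishing from a zero weighted integral.** If `k ≥ 0` is continuous and vanishes on
`t ≤ 0` and on `t ≥ 2`, `h ≥ 0` is continuous and `∫∫ k(x) k(y) h(x, y) = 0`, then `h = 0`
wherever `k(x) > 0` and `k(y) > 0` (a continuous nonnegative integrable function with zero
integral vanishes identically, Lebesgue measure on `ℝ²` charging open sets). [folklore] -/
theorem noFastBlowDown_cell_vanish (k : ℝ → ℝ) (h : ℝ × ℝ → ℝ) (hk : Continuous k)
    (hh : Continuous h) (hk0 : ∀ t, t ≤ 0 → k t = 0) (hk2 : ∀ t, 2 ≤ t → k t = 0)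
    (hkn : ∀ t, 0 ≤ k t) (hhn : ∀ q, 0 ≤ h q) (hint : ∫ q : ℝ × ℝ, k q.1 * k q.2 * h q = 0)
    (q : ℝ × ℝ) (hq1 : 0 < k q.1) (hq2 : 0 < k q.2) : h q = 0 := by
  have hF : Continuous fun q : ℝ × ℝ => k q.1 * k q.2 * h q :=
    ((hk.comp continuous_fst).mul (hk.comp continuous_snd)).mul hh
  have hI : Integrable (fun q : ℝ × ℝ => k q.1 * k q.2 * h q) :=
    noFastBlowDown_cell_integrable_two k k h hk hk hh hk0 hk2 hk0 hk2
  have hae := (integral_eq_zero_iff_of_nonneg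
    (fun p => mul_nonneg (mul_nonneg (hkn _) (hkn _)) (hhn _)) hI).1 hint
  have hzero := (hF.ae_eq_iff_eq volume continuous_zero).1 hae
  have := congrFun hzero q
  simp only [Pi.zero_apply, mul_eq_zero] at this
  rcases this with (h1 | h2) | h3
  · exact absurd h1 hq1.ne'
  · exact absurd h2 hq2.ne'
  · exact h3

/-! ## The registered tools stub -/

/-- Registered tools stub `stub_noFastBlowDownCellTools` of line SketchIdeator4 (crux
`ViscousContinuation`, rate obstruction `NoFastBlowDown`, Tools A): the conjunction of the
two-cell profile package and the five cell-averaging identities of this file. [folklore] -/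
theorem stub_noFastBlowDownCellTools :
    (∃ k k' : ℝ → ℝ, ContDiff ℝ ((⊤ : ℕ∞) : WithTop ℕ∞) k ∧ Continuous k ∧ Continuous k' ∧
      HasCompactSupport k ∧ (∀ t, HasDerivAt k (k' t) t) ∧ (∀ t, 0 ≤ k t) ∧
      (∀ t, 0 < t → t < 2 → 0 < k t) ∧ (∀ t, t ≤ 0 → k t = 0) ∧ (∀ t, 2 ≤ t → k t = 0) ∧
      (∀ t, 0 ≤ t → t ≤ 1 → k t + k (t + 1) = 1) ∧ (∀ t, t ≤ 0 → k' t = 0) ∧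
      (∀ t, 2 ≤ t → k' t = 0) ∧ (∀ t, 0 ≤ t → t ≤ 1 → k' t + k' (t + 1) = 0)) ∧
    (∀ (k k' h : ℝ → ℝ), Continuous k → Continuous k' → Continuous h →
      (∀ t, t ≤ 0 → k t = 0) → (∀ t, 2 ≤ t → k t = 0) →
      (∀ t, 0 ≤ t → t ≤ 1 → k t + k (t + 1) = 1) → (∀ t, t ≤ 0 → k' t = 0) →
      (∀ t, 2 ≤ t → k' t = 0) → (∀ t, 0 ≤ t → t ≤ 1 → k' t + k' (t + 1) = 0) →
      (∀ t, h (t + 1) = h t) → ∫ t, k' t * h t = 0) ∧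
    (∀ (k h : ℝ → ℝ), Continuous k → Continuous h →
      (∀ t, t ≤ 0 → k t = 0) → (∀ t, 2 ≤ t → k t = 0) →
      (∀ t, 0 ≤ t → t ≤ 1 → k t + k (t + 1) = 1) →
      (∀ t, h (t + 1 / 2) = h t) → ∫ t, k t * h (t / 2) = ∫ t, k t * h t) ∧
    (∀ (k : ℝ → ℝ) (h : ℝ × ℝ → ℝ), Continuous k → Continuous h →
      (∀ t, t ≤ 0 → k t = 0) → (∀ t, 2 ≤ t → k t = 0) →
      (∀ t, 0 ≤ t → t ≤ 1 → k t + k (t + 1) = 1) →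
      (∀ q : ℝ × ℝ, h (q.1 + 1 / 2, q.2) = h q) → (∀ q : ℝ × ℝ, h (q.1, q.2 + 1 / 2) = h q) →
      ∫ q : ℝ × ℝ, k q.1 * k q.2 * h (q.1 / 2, q.2 / 2) = ∫ q : ℝ × ℝ, k q.1 * k q.2 * h q) ∧
    (∀ (k k' : ℝ → ℝ) (h : ℝ × ℝ → ℝ), Continuous k → Continuous k' → Continuous h →
      (∀ t, t ≤ 0 → k t = 0) → (∀ t, 2 ≤ t → k t = 0) →
      (∀ t, 0 ≤ t → t ≤ 1 → k t + k (t + 1) = 1) → (∀ t, t ≤ 0 → k' t = 0) →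
      (∀ t, 2 ≤ t → k' t = 0) → (∀ t, 0 ≤ t → t ≤ 1 → k' t + k' (t + 1) = 0) →
      ((∀ q : ℝ × ℝ, h (q.1 + 1, q.2) = h q) → ∫ q : ℝ × ℝ, k' q.1 * k q.2 * h q = 0) ∧
      ((∀ q : ℝ × ℝ, h (q.1, q.2 + 1) = h q) → ∫ q : ℝ × ℝ, k q.1 * k' q.2 * h q = 0)) ∧
    (∀ (k : ℝ → ℝ) (h : ℝ × ℝ → ℝ), Continuous k → Continuous h →
      (∀ t, t ≤ 0 → k t = 0) → (∀ t, 2 ≤ t → k t = 0) → (∀ t, 0 ≤ k t) → (∀ q, 0 ≤ h q) →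
      ∫ q : ℝ × ℝ, k q.1 * k q.2 * h q = 0 → ∀ q : ℝ × ℝ, 0 < k q.1 → 0 < k q.2 → h q = 0) :=
  ⟨noFastBlowDown_cell_profile, noFastBlowDown_cell_integral_deriv, noFastBlowDown_cell_half_one,
    noFastBlowDown_cell_half_two, noFastBlowDown_cell_mixed, noFastBlowDown_cell_vanish⟩

end Summit.AnomalousDissipation.AnomalousDissipation.Theorems
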